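import Summits.CriticalPhenomena.PercolationContinuityZ3.Theorems.Transplant.KNCellsSchemeO
import Summits.CriticalPhenomena.PercolationContinuityZ3.Theorems.Transplant.KNCellsScheme
import Summits.CriticalPhenomena.PercolationContinuityZ3.Theorems.Transplant.KNCellsProcess
import Literature.Probability.Percolation.OrientedHistorySiteRenormalizationRun
import HarnessLib

/-!
# N2 (frames-only node `SamePDropOfSkeletonFrm₁`, OPEN) — ORIENTED MACRO LAYER (WAVE 0 (c1), (R-18) `q ≡ true`): the oriented twin of N1's `KNCellsProcess`

builds on p205010 (kernel theorem, internal audit signed; external expert review pending) — nothing in this file uses p205010; NOTHING is claimed about the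
open node `SamePDropOfSkeletonFrm₁` (`SamePDropOfSkeletonNeg₁` is CLOSED in the tree and untouched by this file).
Status sentence (coordinator 2026-08-20T04:30Z): "θ(p_c) = 0 on ℤ^d, all d ≥ 2 — kernel-verified (Lean 4/Mathlib, standard axioms); internal adversarial
audit SIGNED 2026-08-20 04:29Z; external expert review pending."
Lane `prim-bschramm-*`, seat `prim-bschramm-stmt` (gen 19); helper file (`--supports stmt-CriticalPhenomena-4575 --as helper`); N2-SCOPE §20, (R-18)/(R-19).
PORT RULES (HOME/prim-bschramm-stmt-g19/lean/port_orient.py): the history-site API is replaced by its ORIENTED twin at the fixed quadrant `qNE := fun _ => true`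
(`HState.choice ↦ HState.ochoice qNE`, `mstOf ↦ omstOf qNE`, `mst/stN ↦ omst/ostN qNE`, `occFinal ↦ ooccFinal qNE`, `Lawful ↦ OLawful qNE`, onward directions
`onward ↦ onwardO` = the POSITIVE ones, (N2-e)); every declaration whose text changes thereby — directly or through a changed declaration — is re-declared with the
suffix `O` (same namespace); unchanged declarations of the N1 file are NOT repeated (the N1 module is imported). Docstrings/citations are N1's.
N1 HEADER (kept for the reader):
* `probe h e a` — the adaptive probe of the examination along `e` at source anchor `a` (locality from part 1);
* `astOf` — REPLAY WITH ANCHORS (newest entry first, mirroring `HSiteScheme.mstOf`): the macro-state together with the arrival / departure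
  anchors of the macro-vertices; a recorded probe examines the chosen edge at the source's departure anchor, occupies or blocks the target,
  and sets the target's arrival anchor (:= the source's departure anchor) and departure anchor (read off the record by `depA`);
* `succ h e o := succA h e (dep e.1) o` and **`mst_eq_astOf`**: the `HSiteScheme` replay from `succ` is the macro part of `astOf`;
* `W₀` ((32)'s weighting), `Valid` (anchored (29), (31), (32): pattern facts, root and source column explored, explored region inside the
  anchored `Cover` of determined vertices missing the target and its onward neighbours, and `P(root ↔ M_v in E_i ∪ E_{w,v} | ω|_{E_i}) > 1 - δ`),
  `nextProbe`, `scheme : HSiteScheme V`, `scheme_mst`, `nextProbe_eq_some`, `nextProbe_of_valid`.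

[cite: KozmaNitzan2024, §4 pp. 25–29 ((29), (31), (32)) — the ℤ^d model] [cite: GrimmettPercolation1999, §7.2]
-/
noncomputable section

open MeasureTheory ProbabilityTheory
open scoped ENNReal Classical

namespace Summit.CriticalPhenomena.PercolationContinuityZ3.Theorems

namespace Transplant

namespace KNCells

open Literature.Probability.Percolation Literature.Probability.LatticeModels SimpleGraph GadgetSystem ProbeHistory

variable {V : Type*} [DecidableEq V]

namespace KSchA

variable {A : Type*} {G : SimpleGraph V} [G.LocallyFinite] (S : KSchA V A)

/-! ## The probe -/

variable (G) in
/-- **The adaptive probe of the examination of `v = tgt e` from `e.1`** at source anchor `a` (reveals `E_{w,v}` and the stubs `H^{j_x}_{v,x}`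
at the departure anchor, computing anchor and levels from what it sees). [cite: KozmaNitzan2024, §4 p. 27] -/
def probeO (h : ProbeHistory V) (e : Site 2 × MDir) (a : A) : AProbe V where
  env := S.envO G h e a
  reveal := fun ω => S.revealOfO G h e a (obs ω (S.envO G h e a))
  reveal_subset := fun ω => S.revealOf_subset_envO h e a _
  reveal_local := by
    intro ω ω' hag
    refine S.revealOf_congrO fun x hx => ?_
    have hxe : x ∈ S.envO G h e a := S.revealOf_subset_envO h e a _ hx
    simp only [mem_obs_iff, hxe, true_and]
    exact hag x hx

/-- The observation of the probe agrees with the observation of the envelope on the revealed edges, so success read off either is the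
same. [folklore] -/
theorem succA_read_iffO (h : ProbeHistory V) (e : Site 2 × MDir) (a : A) (ω : BondConfig V) :
    S.succAO G h e a ((S.probeO G h e a).read ω) ↔ S.succAO G h e a (obs ω (S.envO G h e a)) := by
  refine S.succA_congrO fun x hx => ?_
  have hxe : x ∈ S.envO G h e a := S.revealOf_subset_envO h e a _ hx
  simp only [AProbe.read, probeO, mem_obs_iff, hxe, hx, true_and]

/-! ## §4 The anchored replay, validity and the scheme -/

variable (G) in
/-- **Replay with anchors** (newest entry first, mirroring `HSiteScheme.omstOf qNE`): a recorded probe is the examination along the chosen edge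
`e` of the state replayed from the older part, at the source's departure anchor `a`; it occupies the target iff `succAO … a` holds, blocks it
otherwise, and sets the target's arrival anchor to `a` and its departure anchor to the one read off the record.
[cite: KozmaNitzan2024, §4 pp. 25–27] -/
def astOfO : ProbeHistory V → AState A
  | [] => ⟨HSiteScheme.HState.start, fun _ => S.Γ.a₀, fun _ => S.Γ.a₀⟩
  | none :: h => astOfO h
  | some r :: h =>
    match (astOfO h).st.ochoice qNE with
    | none => astOfO h
    | some e =>
      ⟨(astOfO h).st.update e (S.succAO G h e ((astOfO h).dep e.1) r.2),
        Function.update (astOfO h).arr (tgt e) ((astOfO h).dep e.1),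
        Function.update (astOfO h).dep (tgt e) (S.depA G h e ((astOfO h).dep e.1) r.2)⟩

variable (G) in
/-- **Success** of the probe made after `h` along `e`, reading `o`: success at the replayed departure anchor of the source.
[cite: KozmaNitzan2024, §4 p. 27] -/
def succO (h : ProbeHistory V) (e : Site 2 × MDir) (o : Finset (Sym2 V)) : Prop := S.succAO G h e ((S.astOfO G h).dep e.1) o

/-- Replay of the empty history. [folklore] -/
@[simp] theorem astOf_nilO : S.astOfO G [] = ⟨HSiteScheme.HState.start, fun _ => S.Γ.a₀, fun _ => S.Γ.a₀⟩ := rfl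

/-- A `none` step does not change the replayed state. [folklore] -/
@[simp] theorem astOf_cons_noneO (h : ProbeHistory V) : S.astOfO G (none :: h) = S.astOfO G h := rfl

/-- A recorded probe updates the chosen edge, if any, and sets the target's anchors. [folklore] -/
theorem astOf_cons_someO (r : ProbeRecord V) (h : ProbeHistory V) :
    S.astOfO G (some r :: h) = (match (S.astOfO G h).st.ochoice qNE with
      | none => S.astOfO G h
      | some e =>
        ⟨(S.astOfO G h).st.update e (S.succAO G h e ((S.astOfO G h).dep e.1) r.2),
          Function.update (S.astOfO G h).arr (tgt e) ((S.astOfO G h).dep e.1),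
          Function.update (S.astOfO G h).dep (tgt e) (S.depA G h e ((S.astOfO G h).dep e.1) r.2)⟩) := rfl

/-- **The macro-state replayed by the `HSiteScheme` machinery from `succO` is the macro part of the anchored replay.** [folklore] -/
theorem mst_eq_astOfO : ∀ h : ProbeHistory V, HSiteScheme.omstOf qNE (S.succO G) h = (S.astOfO G h).st
  | [] => rfl
  | none :: h => by rw [HSiteScheme.omstOf_cons_none, astOf_cons_noneO]; exact mst_eq_astOfO h
  | some r :: h => by
    rw [HSiteScheme.omstOf_cons_some, mst_eq_astOfO h, astOf_cons_someO]
    cases (S.astOfO G h).st.ochoice qNE <;> rfl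

variable (G) in
/-- **Valid histories** for the examination along `e` (anchored (29), (31), (32)): the explored edges are the edges of `G` inside the explored
region and carry the pattern, the root is explored, the source's column is explored, the explored region lies in the anchored cover of a set of
determined macro-vertices missing the target and its onward neighbours, and the estimate (32) holds at the source's departure anchor:
`P(root ↔ M_v in E_i ∪ E_{w,v} | ω|_{E_i}) > 1 - δ`. [cite: KozmaNitzan2024, §4 pp. 26–28 ((29), (31), (32))] -/
structure ValidO (h : ProbeHistory V) (e : Site 2 × MDir) : Prop where
  F_eq : S.F G h = edgesIn G (S.Vx G h)
  ξ_sub : S.ξ G h ⊆ S.F G h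
  root_mem : S.Γ.root ∈ S.Vx G h
  src_mem : ∃ y ∈ S.Vx G h, y ∈ S.Γ.col e.1
  cover : ∃ det : Set (Site 2), tgt e ∉ det ∧ (∀ du ∈ S.onwardO G h (tgt e), tgt e + stepVec du ∉ det) ∧
    (↑(S.Vx G h) : Set V) ⊆ S.Γ.Cover (S.astOfO G h).arr (S.astOfO G h).dep det
  reach : 1 - S.δc < (prodBernoulli (S.W₀ G h e ((S.astOfO G h).dep e.1))).real
    (⋃ t ∈ S.Γ.M ((S.astOfO G h).dep e.1) (tgt e), openConn S.Γ.root t)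

variable (G) in
/-- The next probe: examine the chosen candidate at the source's departure anchor, but only after a valid history.
[cite: KozmaNitzan2024, §4 p. 27] -/
def nextProbeO (h : ProbeHistory V) : Option (AProbe V) :=
  match (S.astOfO G h).st.ochoice qNE with
  | none => none
  | some e => if S.ValidO G h e then some (S.probeO G h e ((S.astOfO G h).dep e.1)) else none

variable (G) in
/-- **The anchored exploration process** as a history-driven site scheme. [cite: KozmaNitzan2024, §4 pp. 26–27] -/
def schemeO : HSiteScheme V := ⟨⟨S.nextProbeO G⟩, S.U₀ G, S.succO G⟩

/-- The scheme's macro-state is the macro part of the anchored replay. [folklore] -/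
theorem scheme_mstO (h : ProbeHistory V) : (S.schemeO G).omst qNE h = (S.astOfO G h).st := S.mst_eq_astOfO h

/-- If a probe is made, the history is valid for the chosen edge and the probe is the examination at the source's departure anchor. [folklore] -/
theorem nextProbe_eq_someO {h : ProbeHistory V} {P : AProbe V} (hP : S.nextProbeO G h = some P) :
    ∃ e, (S.astOfO G h).st.ochoice qNE = some e ∧ S.ValidO G h e ∧ P = S.probeO G h e ((S.astOfO G h).dep e.1) := by
  unfold nextProbeO at hP
  cases hc : (S.astOfO G h).st.ochoice qNE with
  | none => rw [hc] at hP; simp at hP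
  | some e =>
    rw [hc] at hP
    simp only at hP
    split_ifs at hP with hV
    rw [Option.some.injEq] at hP
    exact ⟨e, rfl, hV, hP.symm⟩

/-- Conversely a valid history with a candidate is probed. [folklore] -/
theorem nextProbe_of_validO {h : ProbeHistory V} {e : Site 2 × MDir}
    (hc : (S.astOfO G h).st.ochoice qNE = some e) (hV : S.ValidO G h e) :
    S.nextProbeO G h = some (S.probeO G h e ((S.astOfO G h).dep e.1)) := by
  unfold nextProbeO; rw [hc]; simp only; rw [if_pos hV]

end KSchA

end KNCells

end Transplant

end Summit.CriticalPhenomena.PercolationContinuityZ3.Theorems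

end
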